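import Summits.NavierStokesRegularity.NavierStokesRegularity.Theses.AxisymmetricExtremality

/-!
# Strategist s9 — typed census signatures for crux `AxisymmetricKatoGlobal`
(stmt-NavierStokesRegularity-15453, route `AxisymmetricExtremality`).

Evidence for STRATEGY-CENSUS-s9.md only: the weaker threshold instance `AxThreshold` (what
`closes` actually consumes), the one honest typed decomposition `AxClayKato ∧ BlowupDescends ⇒ crux`
(assembly proved, pure logic), and the observation that `AxThreshold` could replace the crux in the
deciding theorem (`statement_of_threshold`, same proof as `closes`).  Nothing here is a route edit.
-/

namespace Summit.NavierStokesRegularity.NavierStokesRegularity.Cruxes.AxisymmetricKatoGlobal.StrategistS9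

open MeasureTheory
open Summit.NavierStokesRegularity.NavierStokesRegularity.Theses.AxisymmetricExtremality

local notation "ℝ³" => EuclideanSpace ℝ (Fin 3)
local notation "ℂ³" => EuclideanSpace ℂ (Fin 3)

/-- The route's written-out axisymmetry clause (= `IsAxisymmetric u₀` by `Iff.rfl`). -/
def AxClause (u₀ : ℝ³ → ℝ³) : Prop :=
  ∀ (θ : ℝ) (x : ℝ³), u₀ (WithLp.toLp 2 ![Real.cos θ * x 0 - Real.sin θ * x 1,
    Real.sin θ * x 0 + Real.cos θ * x 1, x 2]) = WithLp.toLp 2 ![Real.cos θ * u₀ x 0 -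
    Real.sin θ * u₀ x 1, Real.sin θ * u₀ x 0 + Real.cos θ * u₀ x 1, u₀ x 2]

/-- (A1) THRESHOLD INSTANCE — the only thing `closes` consumes from the crux: no axisymmetric
Rusin–Šverák minimal blow-up datum exists. -/
def AxThreshold : Prop :=
  ∀ ν : ℝ, 0 < ν → ¬ ∃ (u₀ : ℝ³ → ℝ³)
    (g : Literature.Analysis.FunctionSpaces.HomSobolev ℝ³ ℂ³ (1 / 2 : ℝ)),
    Literature.Analysis.FluidPDE.IsMinimalBlowupDatum ν u₀ g ∧ AxClause u₀

/-- The crux implies its threshold instance (so `AxThreshold` is formally weaker-or-equal). -/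
theorem threshold_of_crux (h : AxisymmetricKatoGlobal) : AxThreshold := by
  intro ν hν ⟨u₀, g, hmin, hax⟩
  obtain ⟨hL3, hrep, hdiv, -, hnot⟩ := hmin
  exact hnot (h ν hν u₀ g hL3 hrep hdiv hax)

/-- `AxThreshold` could replace the crux in the deciding theorem: same proof as `closes`. -/
theorem statement_of_threshold (h₂ : MinimalDatumPFold) (h₄ : PFoldToAxisymmetric)
    (h₃ : AxThreshold) : NavierStokesRegularity := by
  show Literature.NS.NavierStokesExistenceSmoothR3
  intro ν hν u₀ hsm hdiv hdec
  by_contra hno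
  obtain ⟨u₁, g, hmin, hax⟩ := h₄ ν hν (h₂ ν hν ⟨u₀, hsm, hdiv, hdec, hno⟩)
  exact h₃ ν hν ⟨u₁, g, hmin, hax⟩

/-- (A2, piece 1) ns.S25 in Kato form: axisymmetric CLAY data (smooth, divergence free, rapidly
decaying) have global Kato solutions.  This is the named open problem (Ladyzhenskaya 1968). -/
def AxClayKato : Prop :=
  ∀ ν : ℝ, 0 < ν → ∀ u₀ : ℝ³ → ℝ³, ContDiff ℝ (⊤ : ℕ∞) u₀ →
    Literature.Analysis.FluidPDE.NSWave0.IsDivFree u₀ →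
    Literature.Analysis.FluidPDE.HasRapidSpatialDecay u₀ → AxClause u₀ →
    Literature.Analysis.FluidPDE.HasGlobalKatoSolution ν u₀

/-- (A2, piece 2) BLOW-UP DESCENDS TO CLAY DATA: if some axisymmetric critical datum
(`L³`, `Ḣ^{1/2}`-represented, weakly divergence free) has no global Kato solution, then some
axisymmetric Clay datum has none either (robustness of blow-up under smoothing / truncation). -/
def BlowupDescends : Prop :=
  ∀ ν : ℝ, 0 < ν →
    (∃ (u₀ : ℝ³ → ℝ³) (g : Literature.Analysis.FunctionSpaces.HomSobolev ℝ³ ℂ³ (1 / 2 : ℝ)),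
      MemLp u₀ 3 volume ∧
      g.Represents (Literature.Analysis.FunctionSpaces.EuclideanSpace.complexify ∘ u₀) ∧
      Literature.Analysis.FluidPDE.IsWeaklyDivFree u₀ ∧ AxClause u₀ ∧
      ¬ Literature.Analysis.FluidPDE.HasGlobalKatoSolution ν u₀) →
    ∃ v₀ : ℝ³ → ℝ³, ContDiff ℝ (⊤ : ℕ∞) v₀ ∧
      Literature.Analysis.FluidPDE.NSWave0.IsDivFree v₀ ∧
      Literature.Analysis.FluidPDE.HasRapidSpatialDecay v₀ ∧ AxClause v₀ ∧
      ¬ Literature.Analysis.FluidPDE.HasGlobalKatoSolution ν v₀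

/-- ASSEMBLY of the decomposition, proved (pure logic): the two pieces give the crux BY NAME. -/
theorem AxisymmetricKatoGlobal_of_subs (hA : AxClayKato) (hB : BlowupDescends) :
    AxisymmetricKatoGlobal := by
  intro ν hν u₀ g hL3 hrep hdiv hax
  by_contra hno
  obtain ⟨v₀, hsm, hdf, hdec, hax', hnot⟩ := hB ν hν ⟨u₀, g, hL3, hrep, hdiv, hax, hno⟩
  exact hnot (hA ν hν v₀ hsm hdf hdec hax')

/-- Conversely piece 1 is a SPECIAL CASE of the crux modulo the route's own (provable-now) support
item `ClayDatumCritical` (Clay data are critical data). -/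
theorem axClayKato_of_crux (hC : ClayDatumCritical) (h : AxisymmetricKatoGlobal) : AxClayKato := by
  intro ν hν u₀ hsm hdf hdec hax
  obtain ⟨hL3, hdiv, g, hrep⟩ := hC u₀ hsm hdf hdec
  exact h ν hν u₀ g hL3 hrep hdiv hax

/-- … and piece 2 is trivially implied by the crux (its antecedent becomes empty). -/
theorem blowupDescends_of_crux (h : AxisymmetricKatoGlobal) : BlowupDescends := by
  intro ν hν ⟨u₀, g, hL3, hrep, hdiv, hax, hno⟩
  exact absurd (h ν hν u₀ g hL3 hrep hdiv hax) hno

end Summit.NavierStokesRegularity.NavierStokesRegularity.Cruxes.AxisymmetricKatoGlobal.StrategistS9
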